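import Summits.Schanuel.Schanuel.Theorems.RootDecomp1KHyper28

/-!
# RootDecomp1KHyper — lens 6, generation 15 ADDENDUM «EXP-LATTICE-ANCHORED CELL» (ExpAnchorT.lean v2 88910796…, 2341 l) — continuation (RootDecomp1KHyper29): §1 corollaries `algebraicIndependent_option_of_mvWeakMeasure_hyperLat` / `sb_of_hyperLat_of_mvWeakMeasure`; §2 `LatLB`, `latLB_of_mvPolyMeasure`; §3 first half `exists_cvec_ne_zeroL`, `exists_level_dot_ne_zeroL` (uses the tree's `cvec` API of Hyper22)

(lens-6 g15-addendum `ExpAnchorT.lean` v2, sha256 88910796…cc8b, farm rc 0 · 0 sorry · axioms std; port by census-1 gen 14 in eight parts RootDecomp1KHyper28–35, cuts of CENSUS-REQUEST STATUS L1561 re-balanced for the 400-line cap,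
critic PORT GO L1568 (e) / ACK L1571; import `RootDecomp1KHyper26`, the source's verbatim g15 plane-lemma copy dropped (exported by Hyper26 in `…HyperCell`), sub-namespace `…HyperCell.LatCell` kept; statements and proofs verbatim
(55 docstrings added, seven generic one-liners privatised with per-part private copies); `hLW : LWMeasure` (tree-proved named fact) stays a binder; `--supports stmt-Schanuel-33363` (residual of record n = 3 := UnanchoredResidual₃′). Nothing here proves Schanuel; rung 0.)
-/

noncomputable section

open Complex IntermediateField Polynomial

namespace Summit.Schanuel.Schanuel.Theorems.RootDecomp1KHyper

namespace HyperCell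

namespace LatCell

variable {n : ℕ}
open Summit.Schanuel.Schanuel.Theorems.RootDecomp1KGeneric (HasHLPairInSpan Rank3SpanResidual
  mem_adjoin_of_mem_span cexp_mem_adjoin_of_mem_span)

/-- `exp(−x) ≤ 1/x` for `x > 0`. -/
private theorem exp_neg_le_one_div' {x : ℝ} (hx : 0 < x) : Real.exp (-x) ≤ 1 / x := by
  rw [Real.exp_neg, ← one_div]
  exact one_div_le_one_div_of_le hx (by linarith [Real.add_one_le_exp x])

/-- **Weak class principle, lattice version (kernel).** A tuple `θ` with an `MvWeakMeasure` and a
number `y` hyper-approximable from a lattice `ℤ W₁(θ) + ℤ W₂(θ)` form an algebraically independent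
`(n+1)`-tuple `(y, θ₁, …, θₙ)`. -/
theorem algebraicIndependent_option_of_mvWeakMeasure_hyperLat {n : ℕ} {θ : Fin n → ℂ}
    (hθ : MvWeakMeasure θ) (W₁ W₂ : MvPolynomial (Fin n) ℤ) {y : ℂ}
    (hy : HyperLatApprox (MvPolynomial.aeval θ W₁) (MvPolynomial.aeval θ W₂) y) :
    AlgebraicIndependent ℚ (fun o : Option (Fin n) => o.elim y θ) := by
  have hθi := algebraicIndependent_of_mvWeakMeasure hθ
  rw [hθi.option_iff_transcendental]
  intro halg
  obtain ⟨K, G, hGK, hrel⟩ := exists_int_mvrelation halg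
  exact no_int_relation_of_mvWeakMeasure_hyperLat hθ W₁ W₂ hy G ⟨Fin.last K, hGK⟩ hrel

/-- **Cell, several-variables form (kernel).** A tuple `z : Fin (n+1) → ℂ` whose Schanuel field
`ℚ(z, e^z, i)` contains `n` numbers `θ` with a simultaneous weak measure and a number `y`
hyper-approximable from a lattice `ℤ W₁(θ) + ℤ W₂(θ)` has Schanuel's bound `trdeg ≥ n + 1`. -/
theorem sb_of_hyperLat_of_mvWeakMeasure {n : ℕ} {z : Fin (n + 1) → ℂ} {θ : Fin n → ℂ}
    (hθ : MvWeakMeasure θ) (hθz : ∀ j, θ j ∈ adjoin ℚ (SFset z ∪ {I}))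
    (W₁ W₂ : MvPolynomial (Fin n) ℤ) {y : ℂ}
    (hy : HyperLatApprox (MvPolynomial.aeval θ W₁) (MvPolynomial.aeval θ W₂) y)
    (hyz : y ∈ adjoin ℚ (SFset z ∪ {I})) : SB (n + 1) z := by
  have hai := algebraicIndependent_option_of_mvWeakMeasure_hyperLat hθ W₁ W₂ hy
  refine sb_of_algebraicIndependent hai (by simp) fun o => ?_
  cases o with
  | none => exact hyz
  | some j => exact hθz j

/-! ## §2  Polynomial lower bounds for a lattice `ℤ w₁ + ℤ w₂` (from an `MvPolyMeasure`) -/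

/-- **`LatLB w₁ w₂`** — a lower bound, polynomial in the height, for the lattice `ℤ w₁ + ℤ w₂`
away from `0`: `1 ≤ C (1 + |U| + |V|)^τ ‖U w₁ + V w₂‖` for all integers `(U, V) ≠ (0, 0)`
(in particular `w₁, w₂` are ℤ-linearly independent). -/
def LatLB (w₁ w₂ : ℂ) : Prop :=
  ∃ (C : ℝ) (τ : ℕ), 0 < C ∧ ∀ U V : ℤ, (U ≠ 0 ∨ V ≠ 0) →
    1 ≤ C * (1 + |(U : ℝ)| + |(V : ℝ)|) ^ τ * ‖(U : ℂ) * w₁ + (V : ℂ) * w₂‖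

/-- A lattice lower bound forces every non-trivial integer combination `U w₁ + V w₂` to be non-zero. -/
theorem LatLB.ne_zero {w₁ w₂ : ℂ} (h : LatLB w₁ w₂) {U V : ℤ} (hUV : U ≠ 0 ∨ V ≠ 0) :
    (U : ℂ) * w₁ + (V : ℂ) * w₂ ≠ 0 := by
  obtain ⟨C, τ, hC, hall⟩ := h
  intro h0
  have h1 := hall U V hUV
  rw [h0, norm_zero, mul_zero] at h1
  exact absurd h1 (by norm_num)

/-- `LatLB` is symmetric in the two generators. -/
theorem LatLB.symm {w₁ w₂ : ℂ} (h : LatLB w₁ w₂) : LatLB w₂ w₁ := by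
  obtain ⟨C, τ, hC, hall⟩ := h
  refine ⟨C, τ, hC, fun U V hUV => ?_⟩
  have h1 := hall V U (hUV.symm)
  have e : (V : ℂ) * w₁ + (U : ℂ) * w₂ = (U : ℂ) * w₂ + (V : ℂ) * w₁ := by ring
  have e' : (1 : ℝ) + |(V : ℝ)| + |(U : ℝ)| = 1 + |(U : ℝ)| + |(V : ℝ)| := by ring
  rw [e, e'] at h1
  exact h1

/-- The values `W₁(θ), W₂(θ)` of two ℤ-linearly independent integer polynomials at a tuple with an
`MvPolyMeasure` satisfy `LatLB`. -/
theorem latLB_of_mvPolyMeasure {n : ℕ} {θ : Fin n → ℂ} (hθ : MvPolyMeasure θ)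
    (W₁ W₂ : MvPolynomial (Fin n) ℤ)
    (hW : ∀ U V : ℤ, (U ≠ 0 ∨ V ≠ 0) → MvPolynomial.C U * W₁ + MvPolynomial.C V * W₂ ≠ 0) :
    LatLB (MvPolynomial.aeval θ W₁) (MvPolynomial.aeval θ W₂) := by
  obtain ⟨C, τ, hC, h⟩ := hθ (max W₁.totalDegree W₂.totalDegree)
  set Λ : ℝ := 1 + ((mvlen W₁ : ℤ) : ℝ) + ((mvlen W₂ : ℤ) : ℝ) with hΛ
  have hL₁ : (0 : ℝ) ≤ ((mvlen W₁ : ℤ) : ℝ) := by exact_mod_cast mvlen_nonneg _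
  have hL₂ : (0 : ℝ) ≤ ((mvlen W₂ : ℤ) : ℝ) := by exact_mod_cast mvlen_nonneg _
  have hΛ1 : 1 ≤ Λ := by rw [hΛ]; linarith only [hL₁, hL₂]
  refine ⟨C * Λ ^ τ, τ, by positivity, fun U V hUV => ?_⟩
  set P : MvPolynomial (Fin n) ℤ := mvcombo ![U, V] ![W₁, W₂] with hPdef
  have hPeq : P = MvPolynomial.C U * W₁ + MvPolynomial.C V * W₂ := by
    rw [hPdef]; unfold mvcombo; rw [Fin.sum_univ_two]; rfl
  have hP0 : P ≠ 0 := by rw [hPeq]; exact hW U V hUV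
  have hdeg : P.totalDegree ≤ max W₁.totalDegree W₂.totalDegree := by
    rw [hPdef]
    refine totalDegree_mvcombo_le _ _ fun i => ?_
    match i with
    | 0 => exact le_max_left _ _
    | 1 => exact le_max_right _ _
  have hval : MvPolynomial.aeval θ P =
      (U : ℂ) * MvPolynomial.aeval θ W₁ + (V : ℂ) * MvPolynomial.aeval θ W₂ := by
    rw [hPdef, aeval_mvcombo, Fin.sum_univ_two]; rfl
  have hlen : ((mvlen P : ℤ) : ℝ) ≤ (1 + |(U : ℝ)| + |(V : ℝ)|) * Λ := by
    have h1 : ((mvlen P : ℤ) : ℝ) ≤ ((∑ i, |(![U, V] : Fin 2 → ℤ) i| * mvlen ((![W₁, W₂] :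
        Fin 2 → MvPolynomial (Fin n) ℤ) i) : ℤ) : ℝ) := by
      rw [hPdef]; exact_mod_cast mvlen_mvcombo_le _ _
    refine h1.trans ?_
    rw [Fin.sum_univ_two]
    simp only [Matrix.cons_val_zero, Matrix.cons_val_one]
    push_cast
    have hU0 := abs_nonneg (U : ℝ)
    have hV0 := abs_nonneg (V : ℝ)
    nlinarith [mul_nonneg hU0 hL₂, mul_nonneg hV0 hL₁, hL₁, hL₂, mul_nonneg hU0 hL₁,
      mul_nonneg hV0 hL₂]
  have h1 := h P hP0 hdeg
  have hlen0 : (0 : ℝ) ≤ ((mvlen P : ℤ) : ℝ) := by exact_mod_cast mvlen_nonneg _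
  have h2 : ((mvlen P : ℤ) : ℝ) ^ τ ≤ ((1 + |(U : ℝ)| + |(V : ℝ)|) * Λ) ^ τ :=
    pow_le_pow_left₀ hlen0 hlen τ
  rw [hval] at h1
  calc (1 : ℝ) ≤ C * ((mvlen P : ℤ) : ℝ) ^ τ *
        ‖(U : ℂ) * MvPolynomial.aeval θ W₁ + (V : ℂ) * MvPolynomial.aeval θ W₂‖ := h1
    _ ≤ C * ((1 + |(U : ℝ)| + |(V : ℝ)|) * Λ) ^ τ *
        ‖(U : ℂ) * MvPolynomial.aeval θ W₁ + (V : ℂ) * MvPolynomial.aeval θ W₂‖ := by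
          gcongr
    _ = C * Λ ^ τ * (1 + |(U : ℝ)| + |(V : ℝ)|) ^ τ *
        ‖(U : ℂ) * MvPolynomial.aeval θ W₁ + (V : ℂ) * MvPolynomial.aeval θ W₂‖ := by
          rw [mul_pow]; ring

/-! ## §3  Extraction: the coordinates of a lattice-anchored hyper-Liouville triple are `HyperLatApprox` -/

/-- The two anchor coefficient vectors are not parallel: some component of `a × b` is non-zero
(else `a ∥ b` over ℤ and `a_k w₂ − b_k w₁ = 0` with `a_k ≠ 0`, against `LatLB`). -/
theorem exists_cvec_ne_zeroL {z : Fin 3 → ℂ} {w₁ w₂ : ℂ} (hLB : LatLB w₁ w₂)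
    {a b : Fin 3 → ℤ} (ha : ∑ i, (a i : ℂ) * z i = w₁) (hb : ∑ i, (b i : ℂ) * z i = w₂) :
    ∃ j, cvec a b j ≠ 0 := by
  by_contra hall
  push Not at hall
  have h0 : (a 1 : ℂ) * b 2 - a 2 * b 1 = 0 := by exact_mod_cast hall 0
  have h1 : (a 2 : ℂ) * b 0 - a 0 * b 2 = 0 := by exact_mod_cast hall 1
  have h2 : (a 0 : ℂ) * b 1 - a 1 * b 0 = 0 := by exact_mod_cast hall 2
  have hw₁ : w₁ ≠ 0 := by
    have := hLB.ne_zero (U := 1) (V := 0) (Or.inl one_ne_zero)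
    simpa using this
  have ha0 : a ≠ 0 := by
    intro h
    apply hw₁
    rw [← ha]; simp [h]
  obtain ⟨k, hk⟩ := Function.ne_iff.mp ha0
  have ha3 := ha
  have hb3 := hb
  rw [Fin.sum_univ_three] at ha3 hb3
  have hpar : ∀ k : Fin 3, (a k : ℂ) * w₂ = (b k : ℂ) * w₁ := by
    intro k
    rw [← ha3, ← hb3]
    match k with
    | 0 => linear_combination (z 1) * h2 - (z 2) * h1
    | 1 => linear_combination (-(z 0)) * h2 + (z 2) * h0
    | 2 => linear_combination (z 0) * h1 - (z 1) * h0
  have hrel : ((b k : ℤ) : ℂ) * w₁ + ((-a k : ℤ) : ℂ) * w₂ = 0 := by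
    push_cast; linear_combination (-1 : ℂ) * hpar k
  exact hLB.ne_zero (Or.inr (neg_ne_zero.mpr hk)) hrel

/-- **LEMMA L (the small forms are genuinely ternary), lattice version.**  For every sufficiently
high level `m`, a non-zero form `h·z` of size `< exp(−(1+|h|₁)^m)` has `c·h ≠ 0`: otherwise
`c_j (h·z) = A w₁ + B w₂` with `(A, B) ≠ 0` of height `≪ |h|₁`, contradicting `LatLB`. -/
theorem exists_level_dot_ne_zeroL {z : Fin 3 → ℂ} (hz : LinearIndependent ℚ z) {w₁ w₂ : ℂ}
    (hLB : LatLB w₁ w₂) {a b : Fin 3 → ℤ} (ha : ∑ i, (a i : ℂ) * z i = w₁)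
    (hb : ∑ i, (b i : ℂ) * z i = w₂) {j : Fin 3} (hj : cvec a b j ≠ 0) :
    ∃ mL : ℕ, ∀ m : ℕ, mL ≤ m → ∀ h : Fin 3 → ℤ, h ≠ 0 →
      ‖∑ i, (h i : ℂ) * z i‖ < Real.exp (-((1 + ∑ i, |(h i : ℝ)|) ^ m)) →
        (∑ i, cvec a b i * h i) ≠ 0 := by
  obtain ⟨C₀, τ, hC₀, hLBall⟩ := hLB
  set Sa : ℝ := ∑ i, |(a i : ℝ)| with hSa
  set Sb : ℝ := ∑ i, |(b i : ℝ)| with hSb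
  have hSa0 : 0 ≤ Sa := Finset.sum_nonneg fun _ _ => abs_nonneg _
  have hSb0 : 0 ≤ Sb := Finset.sum_nonneg fun _ _ => abs_nonneg _
  set cj : ℝ := |(cvec a b j : ℝ)| with hcj
  have hcj1 : 1 ≤ cj := by rw [hcj, ← Int.cast_abs]; exact_mod_cast Int.one_le_abs hj
  have hcj0 : 0 < cj := by linarith only [hcj1]
  set κ : ℝ := 1 + Sb + Sa with hκ
  have hκ1 : 1 ≤ κ := by rw [hκ]; linarith only [hSa0, hSb0]
  have hκ0 : 0 < κ := by linarith only [hκ1]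
  set κ₁ : ℝ := C₀ * κ ^ τ * cj with hκ₁
  have hκ₁0 : 0 < κ₁ := by positivity
  obtain ⟨T, hT⟩ := exists_le_two_pow κ₁
  refine ⟨T + τ, fun m hm h hh hsmall hC => ?_⟩
  obtain ⟨m', rfl⟩ : ∃ m', m = m' + τ := ⟨m - τ, by omega⟩
  set Sh : ℝ := ∑ i, |(h i : ℝ)| with hSh
  set W : ℝ := 1 + Sh with hW
  have hSh1 : 1 ≤ Sh := one_le_hsum hh
  have hW2 : 2 ≤ W := by rw [hW]; linarith only [hSh1]
  have hW1 : 1 ≤ W := by linarith only [hW2]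
  have hW0 : 0 < W := by linarith only [hW2]
  have hShW : Sh ≤ W := by rw [hW]; linarith only [hSh1]
  set F : ℂ := ∑ i, (h i : ℂ) * z i with hF
  have hF0 : F ≠ 0 := form_ne_zero_of_linearIndependent hz hh
  -- the key identity with `c·h = 0`
  have hkey := cvec_key a b h z j
  rw [← hF, ha, hb, hC] at hkey
  simp only [Int.cast_zero, zero_mul, add_zero] at hkey
  set A : ℤ := cvec h b j with hA
  set B : ℤ := cvec a h j with hB
  have hAB : A ≠ 0 ∨ B ≠ 0 := by
    by_contra hn
    push Not at hn
    obtain ⟨hA0, hB0⟩ := hn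
    have : (cvec a b j : ℂ) * F = 0 := by rw [hkey, hA0, hB0]; simp
    rcases mul_eq_zero.mp this with h1 | h1
    · exact hj (by exact_mod_cast h1)
    · exact hF0 h1
  have hnorm : ‖(A : ℂ) * w₁ + (B : ℂ) * w₂‖ = cj * ‖F‖ := by
    rw [← hkey, norm_mul, Complex.norm_intCast]
  -- lower bound (LatLB) vs upper bound (smallness)
  have hlow := hLBall A B hAB
  rw [hnorm] at hlow
  have hAle : |(A : ℝ)| ≤ Sh * Sb := abs_cvec_le h b j
  have hBle : |(B : ℝ)| ≤ Sa * Sh := abs_cvec_le a h j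
  have hheight : 1 + |(A : ℝ)| + |(B : ℝ)| ≤ κ * W := by
    have h1 : |(A : ℝ)| ≤ W * Sb := hAle.trans (mul_le_mul_of_nonneg_right hShW hSb0)
    have h2 : |(B : ℝ)| ≤ Sa * W := hBle.trans (mul_le_mul_of_nonneg_left hShW hSa0)
    rw [hκ]; nlinarith only [h1, h2, hW1, hSa0, hSb0]
  have hh0 : 0 ≤ 1 + |(A : ℝ)| + |(B : ℝ)| := by positivity
  have hpowle : (1 + |(A : ℝ)| + |(B : ℝ)|) ^ τ ≤ κ ^ τ * W ^ τ := by
    rw [← mul_pow]; exact pow_le_pow_left₀ hh0 hheight τ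
  have hWp : 0 < W ^ (m' + τ) := by positivity
  have hexp : Real.exp (-(W ^ (m' + τ))) ≤ 1 / W ^ (m' + τ) := exp_neg_le_one_div' hWp
  -- 1 ≤ C₀ (κW)^τ cj ‖F‖ < C₀ κ^τ W^τ cj / W^(m'+τ) = κ₁ / W^m'
  have h1 : (1 : ℝ) < κ₁ / W ^ m' := by
    have hFn : ‖F‖ < 1 / W ^ (m' + τ) := hsmall.trans_le hexp
    have hpos : 0 < C₀ * (κ ^ τ * W ^ τ) * cj := by positivity
    calc (1 : ℝ) ≤ C₀ * (1 + |(A : ℝ)| + |(B : ℝ)|) ^ τ * (cj * ‖F‖) := hlow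
      _ ≤ C₀ * (κ ^ τ * W ^ τ) * (cj * ‖F‖) := by gcongr
      _ = C₀ * (κ ^ τ * W ^ τ) * cj * ‖F‖ := by ring
      _ < C₀ * (κ ^ τ * W ^ τ) * cj * (1 / W ^ (m' + τ)) := mul_lt_mul_of_pos_left hFn hpos
      _ = κ₁ / W ^ m' := by
          rw [hκ₁, pow_add]; field_simp
  have h2 : W ^ m' < κ₁ := by
    have hWm : 0 < W ^ m' := by positivity
    rw [lt_div_iff₀ hWm, one_mul] at h1
    exact h1
  have h3 : κ₁ ≤ W ^ m' :=
    calc κ₁ ≤ 2 ^ T := hT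
      _ ≤ W ^ T := pow_le_pow_left₀ (by norm_num) hW2 T
      _ ≤ W ^ m' := pow_le_pow_right₀ hW1 (by omega)
  linarith only [h2, h3]

end LatCell

end HyperCell

end Summit.Schanuel.Schanuel.Theorems.RootDecomp1KHyper
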